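import Summits.BirchSwinnertonDyer.BirchSwinnertonDyer.Theorems.GenusKolyvaginAtTwoPowDvdShaCardAtTwoRTLocalKernelOneBitLocal
import HarnessLib

/-!
# Route `GenusKolyvaginAtTwo`, LINE 18 / LINE 19 (L_T stmt-BirchSwinnertonDyer-23242, L⁺_T stmt-23379) — THE LOWER HALF OF
# KRAMER 1981 PROP. 3: at a ramified good odd prime EVERY rational `2`-torsion point gives a class of the local kernel
# `W_{v,K} = ker(H¹(ℚ_v, E) → H¹(K_w, E))`, so `#W_{v,K} = #E(ℚ_v)[2]` exactly (genus classes exist)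

Seat `bsd-line-gk2-p3` g20 (cell `bsd-f1-sign2`), `--supports stmt-BirchSwinnertonDyer-23242` (helper; closes nothing).
THEOREMS ONLY (no definition, no named fact, no `sorry`); BSD is not proved by any of this.

WHY.  The seat's g17 file `…RTLocalKernelOneBitLocal` proves the UPPER half `#W_{v,K} ≤ #E(ℚ_v)[2]` of Kramer 1981 Prop. 3
(the local norm index at a ramified odd good prime is `i_p = dim E(ℚ_p)[2]`); the LINE 18 genus budgets use only that half.  The
audit of stub J (`Cruxes/PowDvdShaCardAtTwoRT/Lines/plus-descent-stubJ-audit.md`, this seat g20) needs the LOWER half — the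
genus classes EXIST: at a place `w ∣ v` with `K_w/ℚ_v` ramified quadratic, `v ∤ 2` good, the kernel `W_{v,K}` contains, for every
`T ∈ E(ℚ_v)[2]`, the inflated class of the crossed homomorphism `Γ_{ℚ_v} → Γ_{ℚ_v}/Γ_{K_w} ≅ C₂ → {0, T}`, and these are pairwise
distinct.  So `W_{v,K}` is EXACTLY `E(ℚ_v)[2]` in size, i.e. at level `2` «relaxed to `K`-trivial at `p ∣ d_K`» = «no condition».

* §1 (abstract, any topological group `G`, open index-two `N`, coset generator `σ`, discrete `G`-module `M`)
  `exists_cocyclesVanishingOn_of_fixed_two_torsion` (the crossed homomorphism `1_{∉N} · T` of a `G`-fixed `2`-torsion `T`),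
  `eq_zero_of_smul_sub_eq_of_fixed_two_torsion` (injectivity core: with `S = M^N`, `T_k = 2^k S` `σ`-stable uniquely
  `2`-divisible, and `σ` FIXING the `2^k`-torsion of `S`, `σ m − m = T` with `T` a fixed `2`-torsion forces `T = 0`),
  **`exists_injective_fixedTwoTorsion_resKer`**: an injection `M^G[2] ↪ ker(res)` into inflated classes, for every restriction
  map along `θ : H → G` with `θ(H) ≤ N`.
* §2 (fields) **`exists_injective_twoTorsion_localRestrictionKer_of_finrank_eq_two`**: `F` of characteristic `0`, `W/F`, `L/F`
  quadratic with the g17 divisibility datum `k` and ONE `σ ∈ Γ_F ∖ Γ_L` fixing the `2^k`-torsion of `E(L)`: an injection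
  `E(F)[2] ↪ ker(H¹(F,E) → H¹(L,E))`; with g17: `natCard_localRestrictionKer_eq_natCard_twoTorsion_of_finrank_eq_two` (EQUALITY).
* the local application (`E/ℚ` with good reduction at `v ∤ 2`, `K ∋ √d` with `v(d) = 1`, `[K_w : ℚ_v] = 2`:
  `#W_{v,K} = #E(ℚ_v)[2]`) is the sibling file `…RTLocalKernelExact` (2/2).

References: [Kramer1981] §2 Prop. 3 (`i(K/F) = dim E(k)₂`), §4 (11); [MazurRubin2010] Lemma 2.11; [Matsuno2009] §3, Lemma 4.2;
[SerreGaloisCohomology1997] I.§2.4, I.§5.8; [SilvermanAEC2009] VII.4.1, VIII.§1.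
-/

set_option autoImplicit false
-- the Theorems namespace of this sub repeats the summit name by design (D-0017 nested layout)
set_option linter.dupNamespace false

noncomputable section

open scoped Classical

namespace Summit.BirchSwinnertonDyer.BirchSwinnertonDyer.Theorems.GenusExact.PlusDescent

open WeierstrassCurve Literature.NumberTheory.EllipticCurves Literature.NumberTheory.GaloisRepresentations

universe u

/-! ## §1 Index two: the inflated classes of the fixed `2`-torsion -/

section IndexTwoLower

variable {G : Type u} [Group G] [TopologicalSpace G] [IsTopologicalGroup G]
variable {M : Type u} [AddCommGroup M] [DistribMulAction G M] [TopologicalSpace M]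
  [DiscreteTopology M]

omit [TopologicalSpace G] [IsTopologicalGroup G] [TopologicalSpace M] [DiscreteTopology M] in
/-- **The crossed homomorphism of a `G`-fixed `2`-torsion element.**  For `N ≤ G` of index two and `T ∈ M` fixed by `G` with
`2T = 0`, the function `g ↦ 0` (`g ∈ N`), `g ↦ T` (`g ∉ N`) is a crossed homomorphism vanishing on `N` (it is the homomorphism
`G → G/N ≅ ℤ/2 → {0, T}` into a trivial module). [cite: SerreGaloisCohomology1997, I.§2.4] -/
theorem exists_cocyclesVanishingOn_of_fixed_two_torsion (N : Subgroup G) (hidx : N.index = 2) {T : M}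
    (hTfix : ∀ g : G, g • T = T) (hT2 : 2 • T = 0) :
    ∃ f : cocyclesVanishingOn M N, ∀ g : G, (g ∈ N → f.1 g = 0) ∧ (g ∉ N → f.1 g = T) := by
  refine ⟨⟨fun g ↦ if g ∈ N then 0 else T, fun g h ↦ ?_, fun n hn ↦ if_pos hn⟩,
    fun g ↦ ⟨fun hg ↦ if_pos hg, fun hg ↦ if_neg hg⟩⟩
  have hmul : g * h ∈ N ↔ (g ∈ N ↔ h ∈ N) := Subgroup.mul_mem_iff_of_index_two hidx
  change (if g * h ∈ N then (0 : M) else T) = (if g ∈ N then (0 : M) else T) + g • (if h ∈ N then (0 : M) else T)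
  by_cases hg : g ∈ N <;> by_cases hh : h ∈ N
  · rw [if_pos (hmul.mpr (iff_of_true hg hh)), if_pos hg, if_pos hh, smul_zero, add_zero]
  · rw [if_neg (fun hgh ↦ hh ((hmul.mp hgh).mp hg)), if_pos hg, if_neg hh, hTfix, zero_add]
  · rw [if_neg (fun hgh ↦ hg ((hmul.mp hgh).mpr hh)), if_neg hg, if_pos hh, smul_zero, add_zero]
  · rw [if_pos (hmul.mpr (iff_of_false hg hh)), if_neg hg, if_neg hh, hTfix, ← two_nsmul, hT2]

omit [TopologicalSpace G] [IsTopologicalGroup G] [TopologicalSpace M] [DiscreteTopology M] in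
/-- **Injectivity core.**  `N ≤ G`, `σ ∈ G`, `S` the `N`-invariants, `T_k ≤ S` a `σ`-stable subgroup without `2`-torsion in which every
element is twice an element, containing `2^k S`; assume `σ` FIXES every `u ∈ S` with `2^k u = 0`.  If `m ∈ S` and `σ m − m = T` with
`2T = 0`, then `T = 0`.  (Write `2^k m = 2^k t` with `t ∈ T_k`; unique divisibility gives `σ t = t`; `u = m − t` is `2^k`-torsion in
`S`, so `σ u = u`; hence `σ m = m`.)  For `G = Γ_{ℚ_p} ⊇ N = Γ_{K_𝔭}`, `K_𝔭/ℚ_p` ramified, `σ` an inertia element, `M = E(ℚ̄_p)`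
with good reduction at `p ∤ 2`: no rational `2`-torsion point is `σ Q − Q`. [cite: Kramer1981, §2 Prop. 3]
[cite: SilvermanAEC2009, VII.4.1] -/
theorem eq_zero_of_smul_sub_eq_of_fixed_two_torsion (σ : G) (S : AddSubgroup M)
    (Tk : AddSubgroup M) (hTS : Tk ≤ S) (hσT : ∀ t ∈ Tk, σ • t ∈ Tk)
    (hT2 : ∀ t ∈ Tk, 2 • t = 0 → t = 0) (hTdiv : ∀ t ∈ Tk, ∃ u ∈ Tk, t = 2 • u)
    (k : ℕ) (hk : ∀ s ∈ S, 2 ^ k • s ∈ Tk) (htors : ∀ u ∈ S, 2 ^ k • u = 0 → σ • u = u)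
    {m : M} (hm : m ∈ S) {T : M} (hT2' : 2 • T = 0) (h : σ • m - m = T) : T = 0 := by
  -- `T_k` is uniquely `2^j`-divisible
  have hT2pow : ∀ (j : ℕ) (t : M), t ∈ Tk → 2 ^ j • t = 0 → t = 0 := by
    intro j
    induction j with
    | zero => intro t _ ht; rwa [pow_zero, one_nsmul] at ht
    | succ j ih =>
      intro t htT ht
      rw [pow_succ, mul_nsmul'] at ht
      exact ih t htT (hT2 _ (Tk.nsmul_mem htT _) (by rwa [← mul_nsmul', mul_comm, mul_nsmul']))
  have hTdivPow : ∀ (j : ℕ) (t : M), t ∈ Tk → ∃ u ∈ Tk, t = 2 ^ j • u := by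
    intro j
    induction j with
    | zero => exact fun t ht ↦ ⟨t, ht, by rw [pow_zero, one_nsmul]⟩
    | succ j ih =>
      intro t ht
      obtain ⟨u₁, hu₁, rfl⟩ := ih t ht
      obtain ⟨u₂, hu₂, rfl⟩ := hTdiv u₁ hu₁
      exact ⟨u₂, hu₂, by rw [pow_succ, mul_nsmul']⟩
  -- `σ T = T`... not needed; `T ∈ S`
  have hσm : σ • m = m + T := by rw [← h]; abel
  -- `m₁ = 2^k m ∈ T_k` is fixed by `σ`
  have hm₁ : 2 ^ k • m ∈ Tk := hk m hm
  rcases Nat.eq_zero_or_pos k with hk0 | hkpos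
  · -- `k = 0`: `S ⊆ T_k` has no `2`-torsion
    subst hk0
    rw [pow_zero, one_nsmul] at hm₁
    have hTmem : T ∈ Tk := by
      rw [← h]
      exact Tk.sub_mem (hσT m hm₁) hm₁
    exact hT2 T hTmem hT2'
  · have h2k : 2 ^ k • T = 0 := by
      obtain ⟨j, rfl⟩ : ∃ j, k = j + 1 := ⟨k - 1, by omega⟩
      rw [pow_succ, mul_nsmul', hT2', nsmul_zero]
    have hσm₁ : σ • (2 ^ k • m) = 2 ^ k • m := by
      rw [smul_comm σ (2 ^ k) m, hσm, nsmul_add, h2k, add_zero]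
    -- `2^k m = 2^k t`, `t ∈ T_k`, `σ t = t`
    obtain ⟨t, ht, hmt⟩ := hTdivPow k _ hm₁
    have hσt : σ • t = t := by
      have h1 : 2 ^ k • (σ • t - t) = 0 := by
        rw [nsmul_sub, ← smul_comm σ (2 ^ k) t, ← hmt, hσm₁, sub_self]
      have h2 := hT2pow k _ (Tk.sub_mem (hσT t ht) ht) h1
      rwa [sub_eq_zero] at h2
    -- `u = m - t` is `2^k`-torsion in `S`
    have hu : σ • (m - t) = m - t := by
      refine htors _ (S.sub_mem hm (hTS ht)) ?_
      rw [nsmul_sub, ← hmt, sub_self]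
    rw [smul_sub, hσt, hσm] at hu
    -- `m + T - t = m - t`
    have : T = 0 := by
      have h3 := congrArg (fun x ↦ x - (m - t)) hu
      simp only [sub_self] at h3
      rw [← h3]; abel
    exact this

variable {H : Type u} [Group H] [TopologicalSpace H] [IsTopologicalGroup H]
variable {M' : Type u} [AddCommGroup M'] [DistribMulAction H M'] [TopologicalSpace M'] [DiscreteTopology M']

/-- **The fixed `2`-torsion injects into the kernel of restriction.**  `N ≤ G` open of index two with coset generator `σ`, `S = M^N`,
`T_k ⊇ 2^k S` a `σ`-stable uniquely `2`-divisible subgroup of `S`, and `σ` fixing the `2^k`-torsion of `S`.  Then for every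
restriction datum `(θ : H → G, ψ : M → M')` with `θ(H) ≤ N` there is an INJECTION of `M^G[2] = {T : σT = T ∧ T ∈ S ∧ 2T = 0}`… stated
on `{T ∈ M : (∀ g, g T = T) ∧ 2 T = 0}` … into `ker(res) ≤ H¹_cont(G, M)`, `T ↦` the inflated class of `1_{∉N}·T`
(`exists_cocyclesVanishingOn_of_fixed_two_torsion`; it dies on `θ(H) ⊆ N`; injective by
`eq_zero_of_smul_sub_eq_of_fixed_two_torsion`). [cite: Kramer1981, §2 Prop. 3] [cite: SerreGaloisCohomology1997, I.§2.4 and I.§5.8] -/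
theorem exists_injective_fixedTwoTorsion_resKer (N : Subgroup G) (hN : IsOpen (N : Set G)) (hidx : N.index = 2)
    {σ : G} (hσN : σ ∉ N) (S : AddSubgroup M) (hS : ∀ m : M, m ∈ S ↔ ∀ n ∈ N, n • m = m)
    (Tk : AddSubgroup M) (hTS : Tk ≤ S) (hσT : ∀ t ∈ Tk, σ • t ∈ Tk)
    (hT2 : ∀ t ∈ Tk, 2 • t = 0 → t = 0) (hTdiv : ∀ t ∈ Tk, ∃ u ∈ Tk, t = 2 • u)
    (k : ℕ) (hk : ∀ s ∈ S, 2 ^ k • s ∈ Tk) (htors : ∀ u ∈ S, 2 ^ k • u = 0 → σ • u = u)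
    (θ : H →ₜ* G) (ψ : M →+ M') (hθψ : ∀ (x : H) (m : M), ψ (θ x • m) = x • ψ m)
    (hθN : (θ : H →* G).range ≤ N) :
    ∃ ι : {T : M // (∀ g : G, g • T = T) ∧ 2 • T = 0} → discreteH1 G M,
      Function.Injective ι ∧ (∀ T, ι T ∈ resKer θ ψ hθψ) ∧ ∀ T, ι T ∈ (inflClass M N hN).range := by
  -- the cocycles
  have hf : ∀ T : {T : M // (∀ g : G, g • T = T) ∧ 2 • T = 0},
      ∃ f : cocyclesVanishingOn M N, ∀ g : G, (g ∈ N → f.1 g = 0) ∧ (g ∉ N → f.1 g = T.1) := fun T ↦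
    exists_cocyclesVanishingOn_of_fixed_two_torsion N hidx T.2.1 T.2.2
  choose f hf using hf
  refine ⟨fun T ↦ inflClass M N hN (f T), fun T T' hTT' ↦ ?_, fun T ↦ ?_, fun T ↦ ⟨f T, rfl⟩⟩
  · -- injectivity: the difference cocycle is a coboundary `g ↦ g m - m`, `m ∈ S`, `σ m - m = T - T'`
    have h0 : inflClass M N hN (f T - f T') = 0 := by rw [map_sub, sub_eq_zero]; exact hTT'
    rw [inflClass_apply, oneCocycleClass_eq_zero_iff] at h0
    obtain ⟨m, hm⟩ := h0
    have hm' : ∀ g : G, (f T).1 g - (f T').1 g = g • m - m := fun g ↦ by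
      have := hm g
      rwa [discreteTopRep_ρ_apply, toContOneCocycle_apply] at this
    have hmS : m ∈ S := by
      rw [hS]
      intro n hn
      have := hm' n
      rw [((hf T) n).1 hn, ((hf T') n).1 hn, sub_self, eq_comm, sub_eq_zero] at this
      exact this
    have hσ : σ • m - m = T.1 - T'.1 := by rw [← hm' σ, ((hf T) σ).2 hσN, ((hf T') σ).2 hσN]
    have h2 : 2 • (T.1 - T'.1) = 0 := by rw [nsmul_sub, T.2.2, T'.2.2, sub_self]
    have hzero := eq_zero_of_smul_sub_eq_of_fixed_two_torsion σ S Tk hTS hσT hT2 hTdiv k hk htors hmS h2 hσ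
    exact Subtype.ext (sub_eq_zero.mp hzero)
  · -- dies on `θ(H) ⊆ N`
    change inflClass M N hN (f T) ∈ resKer θ ψ hθψ
    rw [inflClass_apply, oneCocycleClass_mem_resKer_iff]
    refine ⟨0, fun x ↦ ?_⟩
    rw [toContOneCocycle_apply, ((hf T) (θ x)).1 (hθN ⟨x, rfl⟩), map_zero, smul_zero, sub_zero]

end IndexTwoLower

/-! ## §2 Quadratic extensions of a field of characteristic `0`: `E(F)[2] ↪ ker(H¹(F, E) → H¹(L, E))` -/

section Quadratic

open IntermediateField

variable {F : Type u} [Field F] (W : WeierstrassCurve F) (L : Type u) [Field L] [Algebra F L]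

/-- **`E(F)[2] ↪ ker(H¹(F, E) → H¹(L, E))` for a quadratic `L/F`** (`F` of characteristic `0`, `W/F` any Weierstrass curve) with
the g17 divisibility datum (`2^k E(L)` has no `2`-torsion and lies in `2^{k+1} E(L)`) and ONE `σ ∈ Γ_F ∖ Γ_L` FIXING the `2^k`-torsion of
`E(L)` (at a totally ramified `K_𝔭/ℚ_p` of good odd residue characteristic: any inertia element moving `√d`).  The injection sends a
rational `2`-torsion point `T` to the inflated class of `Γ_F → Gal(L/F) → {0, T}`. [cite: Kramer1981, §2 Prop. 3]
[cite: SerreGaloisCohomology1997, I.§2.4 and I.§5.8] -/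
theorem exists_injective_twoTorsion_localRestrictionKer_of_finrank_eq_two [CharZero F] [FiniteDimensional F L]
    (h2 : Module.finrank F L = 2) (k : ℕ)
    (hk2 : ∀ P : (W.baseChange L).toAffine.Point, 2 • (2 ^ k • P) = 0 → 2 ^ k • P = 0)
    (hkdiv : ∀ P : (W.baseChange L).toAffine.Point,
      ∃ Q : (W.baseChange L).toAffine.Point, 2 ^ k • P = 2 • (2 ^ k • Q))
    (hσ : ∃ σ : Field.absoluteGaloisGroup F, σ ∉ galRange (K := F) L ∧
      ∀ u : geomPoints W, (∀ n ∈ galRange (K := F) L, n • u = u) → 2 ^ k • u = 0 → σ • u = u) :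
    ∃ ι : {P : (W.baseChange F).toAffine.Point // 2 • P = 0} → W.localRestrictionKer L, Function.Injective ι := by
  haveI : Algebra.IsAlgebraic F L := Algebra.IsAlgebraic.of_finite F L
  haveI : IsGalois F (AlgebraicClosure F) := {}
  obtain ⟨σ, hσN, hσfix⟩ := hσ
  -- the copy `j : L → F̄`, its field range `F'`, the open index-two subgroup `N = Γ_L`
  set e : AlgebraicClosure F ≃ₐ[F] AlgebraicClosure L := algEquivOfEmb L (closureEmb (K := F) L) with he
  set j : L →ₐ[F] AlgebraicClosure F :=
    ((e.symm : AlgebraicClosure L →ₐ[F] AlgebraicClosure F).comp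
      (IsScalarTower.toAlgHom F L (AlgebraicClosure L))) with hj
  set F' : IntermediateField F (AlgebraicClosure F) := j.fieldRange with hF'
  set N : Subgroup (Field.absoluteGaloisGroup F) := galRange (K := F) L with hNdef
  have hN : N = F'.fixingSubgroup := galRange_eq_fixingSubgroup_fieldRange L
  let eL : L ≃ₐ[F] F' := AlgHom.equivFieldRange j
  haveI : FiniteDimensional F F' := LinearEquiv.finiteDimensional eL.toLinearEquiv
  have hNopen : IsOpen (N : Set (Field.absoluteGaloisGroup F)) := by
    rw [hN]; exact IntermediateField.fixingSubgroup_isOpen F'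
  have hidx : N.index = 2 := by
    rw [hN]
    refine ((IntermediateField.finrank_eq_fixingSubgroup_index F').symm.trans ?_)
    rw [← eL.toLinearEquiv.finrank_eq, h2]
  haveI : N.Normal := Subgroup.normal_of_index_eq_two hidx
  -- the invariants `S = E(F') ≅ E(L)`
  set m : (W.baseChange F').toAffine.Point →+ geomPoints W :=
    WeierstrassCurve.Affine.Point.map (W' := W) (F'.val : F' →ₐ[F] AlgebraicClosure F) with hm
  have hminj : Function.Injective m := WeierstrassCurve.Affine.Point.map_injective _
  set S : AddSubgroup (geomPoints W) := m.range with hSdef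
  have hS : ∀ P : geomPoints W, P ∈ S ↔ ∀ n ∈ N, n • P = P := by
    intro P
    rw [hN]
    refine ⟨?_, mem_range_map_val_of_forall_smul_eq W F' P⟩
    rintro ⟨Q, rfl⟩ τ hτ
    exact smul_eq_of_map_val_eq W F' Q _ rfl hτ
  let m₁ : (W.baseChange L).toAffine.Point →+ (W.baseChange F').toAffine.Point :=
    WeierstrassCurve.Affine.Point.map (W' := W) (eL : L →ₐ[F] F')
  have hm₁ : Function.Bijective m₁ := by
    refine ⟨WeierstrassCurve.Affine.Point.map_injective _, fun Q ↦
      ⟨WeierstrassCurve.Affine.Point.map (W' := W) (eL.symm : F' →ₐ[F] L) Q, ?_⟩⟩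
    change WeierstrassCurve.Affine.Point.map _ (WeierstrassCurve.Affine.Point.map _ Q) = Q
    rw [WeierstrassCurve.Affine.Point.map_map, AlgEquiv.comp_symm]
    cases Q <;> rfl
  let eS : (W.baseChange L).toAffine.Point ≃+ S :=
    (AddEquiv.ofBijective m₁ hm₁).trans (AddMonoidHom.ofInjective hminj)
  have heS : ∀ P : (W.baseChange L).toAffine.Point, ((eS P : S) : geomPoints W) = m (m₁ P) := fun _ ↦ rfl
  -- `T_k = 2^k S`: `σ`-stable, uniquely `2`-divisible
  set Tk : AddSubgroup (geomPoints W) := S.map (nsmulAddMonoidHom (2 ^ k) : geomPoints W →+ _) with hTdef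
  have hTS : Tk ≤ S := by
    rintro _ ⟨s, hs, rfl⟩
    exact S.nsmul_mem hs _
  have hσT : ∀ t ∈ Tk, σ • t ∈ Tk := by
    rintro _ ⟨s, hs, rfl⟩
    refine ⟨σ • s, smul_mem_of_invariants hS hs σ, ?_⟩
    rw [nsmulAddMonoidHom_apply, nsmulAddMonoidHom_apply, smul_comm σ (2 ^ k : ℕ) s]
  have hT2 : ∀ t ∈ Tk, 2 • t = 0 → t = 0 := by
    rintro _ ⟨s, hs, rfl⟩ h0
    obtain ⟨P, hP⟩ := eS.surjective ⟨s, hs⟩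
    have hsP : s = ((eS P : S) : geomPoints W) := by rw [hP]
    rw [nsmulAddMonoidHom_apply, hsP, heS, ← map_nsmul, ← map_nsmul] at h0 ⊢
    rw [← map_nsmul, ← map_nsmul] at h0
    have h0' : 2 • (2 ^ k • P) = 0 := hm₁.1 (hminj (by rw [h0, map_zero, map_zero]))
    rw [hk2 P h0', map_zero, map_zero]
  have hTdiv : ∀ t ∈ Tk, ∃ u ∈ Tk, t = 2 • u := by
    rintro _ ⟨s, hs, rfl⟩
    obtain ⟨P, hP⟩ := eS.surjective ⟨s, hs⟩
    have hsP : s = ((eS P : S) : geomPoints W) := by rw [hP]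
    obtain ⟨Q, hQ⟩ := hkdiv P
    refine ⟨(2 ^ k : ℕ) • ((eS Q : S) : geomPoints W), ⟨_, (eS Q).2, rfl⟩, ?_⟩
    rw [nsmulAddMonoidHom_apply, hsP, heS, heS, ← map_nsmul, ← map_nsmul, hQ, map_nsmul, map_nsmul, map_nsmul,
      map_nsmul]
  have hk : ∀ s ∈ S, 2 ^ k • s ∈ Tk := fun s hs ↦ ⟨s, hs, rfl⟩
  have htors : ∀ u ∈ S, 2 ^ k • u = 0 → σ • u = u := fun u hu h0 ↦ hσfix u ((hS u).mp hu) h0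
  -- §1
  obtain ⟨ι₀, hι₀, hker, -⟩ := exists_injective_fixedTwoTorsion_resKer N hNopen hidx hσN S hS Tk hTS hσT hT2 hTdiv k hk
    htors (resGal (K := F) L) (pointsMap W L) (pointsMap_smul W L) (by rw [hNdef]; exact le_rfl)
  -- `E(F)[2] ↪ M^G[2]`
  let toGeom : (W.baseChange F).toAffine.Point →+ geomPoints W := Affine.Point.baseChange F (AlgebraicClosure F)
  have hbinj : Function.Injective toGeom := Affine.Point.map_injective _
  have hfix : ∀ (P₀ : (W.baseChange F).toAffine.Point) (g : Field.absoluteGaloisGroup F), g • toGeom P₀ = toGeom P₀ := by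
    intro P₀
    have hx : toGeom P₀ ∈ MulAction.fixedPoints (Field.absoluteGaloisGroup F) (geomPoints W) := by
      rw [fixedPoints_eq_range_map_holds W]
      exact ⟨P₀, rfl⟩
    exact hx
  have h2 : ∀ P : {P : (W.baseChange F).toAffine.Point // 2 • P = 0}, 2 • toGeom P.1 = 0 := fun P ↦ by
    rw [← map_nsmul, P.2, map_zero]
  refine ⟨fun P ↦ ⟨ι₀ ⟨toGeom P.1, hfix P.1, h2 P⟩, hker _⟩, fun P P' hPP' ↦ ?_⟩
  have h1 := hι₀ (Subtype.ext_iff.mp hPP')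
  exact Subtype.ext (hbinj (Subtype.ext_iff.mp h1))

/-- **`#ker(H¹(F, E) → H¹(L, E)) = #E(F)[2]` exactly** in the same situation, when moreover `E(L)/2^k E(L)` is finite and `E(F)[2]` is
finite (the UPPER half is the seat's g17 `natCard_localRestrictionKer_le_of_finrank_eq_two`). [cite: Kramer1981, §2 Prop. 3] -/
theorem natCard_localRestrictionKer_eq_natCard_twoTorsion_of_finrank_eq_two [CharZero F] [FiniteDimensional F L]
    (h2 : Module.finrank F L = 2) (k : ℕ)
    (hk2 : ∀ P : (W.baseChange L).toAffine.Point, 2 • (2 ^ k • P) = 0 → 2 ^ k • P = 0)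
    (hkdiv : ∀ P : (W.baseChange L).toAffine.Point,
      ∃ Q : (W.baseChange L).toAffine.Point, 2 ^ k • P = 2 • (2 ^ k • Q))
    (hfin : Finite ((W.baseChange L).toAffine.Point ⧸
      (nsmulAddMonoidHom (2 ^ k) : (W.baseChange L).toAffine.Point →+ _).range))
    (hF2 : Finite {P : (W.baseChange F).toAffine.Point // 2 • P = 0})
    (hσ : ∃ σ : Field.absoluteGaloisGroup F, σ ∉ galRange (K := F) L ∧
      ∀ u : geomPoints W, (∀ n ∈ galRange (K := F) L, n • u = u) → 2 ^ k • u = 0 → σ • u = u) :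
    Nat.card (W.localRestrictionKer L) = Nat.card {P : (W.baseChange F).toAffine.Point // 2 • P = 0} := by
  obtain ⟨hfinK, hle⟩ := natCard_localRestrictionKer_le_of_finrank_eq_two W L h2 k hk2 hkdiv hfin hF2
  obtain ⟨ι, hι⟩ := exists_injective_twoTorsion_localRestrictionKer_of_finrank_eq_two W L h2 k hk2 hkdiv hσ
  haveI := hfinK
  exact le_antisymm hle (Nat.card_le_card_of_injective ι hι)

end Quadratic

end Summit.BirchSwinnertonDyer.BirchSwinnertonDyer.Theorems.GenusExact.PlusDescent

end
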